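/-
Copyright (c) 2026. All rights reserved.
Released under Apache 2.0 license as described in the file LICENSE.
Authors: abc-iut cell, seat abc-iut-w5-d024 (gen 5).
-/
import Literature.AnabelianGeometry.AbsoluteAnabelian.FundamentalExtension
import Literature.GroupTheory.TopologicallyCyclicIndex
import Mathlib.Topology.Algebra.ClopenNhdofOne
import Mathlib.Topology.Algebra.OpenSubgroup
import Mathlib.GroupTheory.Index

/-!
# Procyclic lifts of a free procyclic quotient meet the kernel trivially

Let `G` be a profinite group and `G₁ ⊴ G` a closed normal subgroup with `G ⧸ G₁` FREE PROCYCLIC (`≅ Ẑ`,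
in the sense of the tree's intrinsic predicate
`Literature.AnabelianGeometry.AbsoluteAnabelian.FundamentalExtension.IsFreeProcyclic`: a dense cyclic
subgroup and an open subgroup of every positive index).  If `ψ ∈ G` is such that the procyclic group
`Ψ = cl⟨ψ⟩` supplements `G₁` (`Ψ ⊔ G₁ = ⊤`), then `Ψ ∩ G₁ = 1`
(`topologicalClosure_zpowers_inf_eq_bot_of_isFreeProcyclic`): a procyclic group surjecting onto `Ẑ`
does so isomorphically.

Proof (Hopfian argument at finite level): if `1 ≠ k ∈ Ψ ∩ G₁`, choose an open normal `V ∌ k` and let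
`m = [Ψ : Ψ ∩ V]`; the preimage in `Ψ` of the open subgroup of index `m` of `G ⧸ G₁` and `Ψ ∩ V` are two
open subgroups of index `m` of the topologically cyclic group `Ψ`, hence EQUAL (tree:
`Subgroup.eq_of_isOpen_of_index_eq_of_dense_zpowers`), so `k ∈ V` — absurd.

This is the hypothesis `hfree` of
`Literature.GroupTheory.exists_closed_complement_of_procyclic_quotient` (splitting of a profinite
group over a pro-`p` normal subgroup, file `ProfiniteComplementLift.lean`); at `G = Γ_F`, `G₁ = I_F` it
is supplied by `isFreeProcyclic_quotient_galUnr` (`Gal(F^nr/F) ≅ Ẑ`).  Classical profinite group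
theory [cite: RibesZalesskii2010, §2.5 (procyclic groups)]; no definitions.
-/

namespace Literature.GroupTheory

open _root_.Subgroup Topology
open Literature.AnabelianGeometry.AbsoluteAnabelian

universe u

section Profinite

variable {G : Type u} [Group G] [TopologicalSpace G] [IsTopologicalGroup G] [CompactSpace G]
  [T2Space G] [TotallyDisconnectedSpace G]

omit [CompactSpace G] [T2Space G] [TotallyDisconnectedSpace G] in
/-- The cyclic subgroup generated by `ψ` is dense in the subgroup `cl⟨ψ⟩` (subspace topology). [folklore] -/
private theorem dense_zpowers_mk_topologicalClosure (ψ : G) :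
    Dense (zpowers (⟨ψ, Subgroup.le_topologicalClosure _ (mem_zpowers ψ)⟩ :
      (zpowers ψ).topologicalClosure) : Set (zpowers ψ).topologicalClosure) := by
  set Ψ := (zpowers ψ).topologicalClosure
  set ψ' : Ψ := ⟨ψ, Subgroup.le_topologicalClosure _ (mem_zpowers ψ)⟩
  rw [Topology.IsInducing.subtypeVal.dense_iff]
  intro x
  have himage : Subtype.val '' (zpowers ψ' : Set Ψ) = (zpowers ψ : Set G) := by
    ext y
    constructor
    · rintro ⟨z, ⟨n, rfl⟩, rfl⟩
      exact ⟨n, by simp [ψ']⟩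
    · rintro ⟨n, rfl⟩
      exact ⟨ψ' ^ n, ⟨n, rfl⟩, by simp [ψ']⟩
  have hx : (x : G) ∈ _root_.closure (zpowers ψ : Set G) := by
    rw [← Subgroup.topologicalClosure_coe]; exact x.2
  convert hx using 2
  exact himage

/-- **A procyclic supplement of a free procyclic quotient meets the kernel trivially.** Let `G` be
profinite, `G₁ ⊴ G` with `G ⧸ G₁` free procyclic (`IsFreeProcyclic`), and `ψ ∈ G` with
`cl⟨ψ⟩ ⊔ G₁ = ⊤`. Then `cl⟨ψ⟩ ⊓ G₁ = ⊥`. [cite: RibesZalesskii2010, §2.5] -/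
theorem topologicalClosure_zpowers_inf_eq_bot_of_isFreeProcyclic (G₁ : Subgroup G) [G₁.Normal]
    (hfree : FundamentalExtension.IsFreeProcyclic (G ⧸ G₁)) (ψ : G)
    (hψ : (zpowers ψ).topologicalClosure ⊔ G₁ = ⊤) :
    (zpowers ψ).topologicalClosure ⊓ G₁ = ⊥ := by
  classical
  set Ψ : Subgroup G := (zpowers ψ).topologicalClosure with hΨdef
  have hΨc : IsClosed (Ψ : Set G) := Subgroup.isClosed_topologicalClosure _
  haveI : CompactSpace Ψ := isCompact_iff_compactSpace.mp hΨc.isCompact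
  set ψ' : Ψ := ⟨ψ, Subgroup.le_topologicalClosure _ (mem_zpowers ψ)⟩ with hψ'
  have hdense : Dense (zpowers ψ' : Set Ψ) := dense_zpowers_mk_topologicalClosure ψ
  rw [eq_bot_iff]
  intro k hk
  rw [Subgroup.mem_bot]
  by_contra hk1
  -- an open normal `V ∌ k`
  obtain ⟨V, hV⟩ := ProfiniteGrp.exist_openNormalSubgroup_sub_open_nhds_of_one
    (isOpen_compl_singleton (x := k)) (by simpa using fun h => hk1 h.symm)
  have hkV : k ∉ (V : Subgroup G) := fun h => hV h rfl
  -- `A = Ψ ∩ V` as a subgroup of `Ψ`, closed of finite index `m`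
  set A : Subgroup Ψ := (V : Subgroup G).subgroupOf Ψ with hA
  have hAo : IsOpen (A : Set Ψ) := V.toOpenSubgroup.isOpen.preimage continuous_subtype_val
  set m : ℕ := A.index with hm
  have hm0 : 0 < m := by
    rw [hm, hA]
    have hdvd := Subgroup.relIndex_dvd_index_of_normal (V : Subgroup G) Ψ
    haveI : Finite (G ⧸ (V : Subgroup G)) := inferInstance
    have hne : (V : Subgroup G).index ≠ 0 := Subgroup.index_ne_zero_of_finite
    have hrel : (V : Subgroup G).relIndex Ψ ≠ 0 := fun h0 => hne (zero_dvd_iff.mp (h0 ▸ hdvd))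
    exact Nat.pos_of_ne_zero hrel
  -- the surjection `f : Ψ → G ⧸ G₁`
  let f : Ψ →* G ⧸ G₁ := (QuotientGroup.mk' G₁).restrict Ψ
  have hfcont : Continuous f := (QuotientGroup.continuous_mk).comp continuous_subtype_val
  have hfsurj : Function.Surjective f := by
    rintro ⟨x⟩
    have hx : x ∈ ((Ψ ⊔ G₁ : Subgroup G) : Set G) := by rw [hψ]; exact Set.mem_univ x
    rw [Subgroup.mul_normal] at hx
    obtain ⟨y, hy, g, hg, rfl⟩ := Set.mem_mul.mp hx
    refine ⟨⟨y, hy⟩, ?_⟩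
    change (QuotientGroup.mk y : G ⧸ G₁) = QuotientGroup.mk (y * g)
    rw [QuotientGroup.eq, ← mul_assoc, inv_mul_cancel, one_mul]
    exact hg
  -- `B =` preimage of the open subgroup of index `m` of `G ⧸ G₁`
  obtain ⟨H, hHo, hHidx⟩ := hfree.exists_isOpen_index m hm0
  set B : Subgroup Ψ := H.comap f with hB
  have hBo : IsOpen (B : Set Ψ) := hHo.preimage hfcont
  have hBidx : B.index = m := by rw [hB, Subgroup.index_comap_of_surjective _ hfsurj, hHidx]
  -- `A = B`: open subgroups of the same finite index in a topologically cyclic group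
  have hAB : A = B :=
    Subgroup.eq_of_isOpen_of_index_eq_of_dense_zpowers hdense hAo hBo (ne_of_gt hm0) (hm ▸ hBidx.symm)
  -- but `k ∈ B` (it dies in `G ⧸ G₁`) and `k ∉ A`
  have hkB : (⟨k, hk.1⟩ : Ψ) ∈ B := by
    rw [hB, Subgroup.mem_comap]
    have : f ⟨k, hk.1⟩ = 1 := by
      change (QuotientGroup.mk k : G ⧸ G₁) = 1
      exact (QuotientGroup.eq_one_iff k).mpr hk.2
    rw [this]
    exact one_mem H
  rw [← hAB, hA, Subgroup.mem_subgroupOf] at hkB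
  exact hkV hkB

end Profinite

end Literature.GroupTheory
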